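import Summits.ValiantsHypothesis.ValiantsHypothesis.Theorems.SymmetroidDescartesQuasiRolleToDescartes
import Summits.ValiantsHypothesis.ValiantsHypothesis.Theorems.SymmetroidDescartesDerivedPencilRolleRefutation

/-!
# `DerivedPencilRolleQuasi` — negative lemma: the exponent `A` is at least `2`

Crux `stmt-ValiantsHypothesis-18064` (`Theses.SymmetroidDescartes.DerivedPencilRolleQuasi`, route
SymmetroidDescartes): `∃ C A, ∀ m K S d (symmetric, invertible, d strictly increasing),
Z₊(det F) ≤ C · Z₊(det ∂F) + (K+1)^(A·K) · 2^((log₂ m + 2)^A)`.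

Refuter (cdisprove) finding, 2026-08-17: **the `A = 1` slice of the crux is false for every `C`**, so
any witnessing constants have `A ≥ 2` — the slack must be genuinely super-LINEAR in the size `m`
(at `A = 1` the budget `(K+1)^K · 2^(log₂ m + 2) ≤ (K+1)^K · 4m` is linear in `m` for each fixed number
of terms).  This formalises remark (i) of `…/Negative/DerivedPencilRolleQuasiExponentFloor.lean`
(which landed `A ≥ 1` from the `2 × 2` indefinite four-nomial witness).

Proof.  The tree's abstract-budget glue (`posRoots_le_of_step`, `alternations_le_of_step`,
`quasiBudget_mono`, file `Theorems/SymmetroidDescartesQuasiRolleToDescartes.lean`) turns the `A = 1`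
step into the bound `N ≤ K · C'^K · (K+1)^K · 2^(log₂ m + 2)` (`C' = max C 1`) on the number `N` of
strict sign alternations of `det` of EVERY real symmetric `K`-term lacunary pencil of size `m`; the
tree's STAIRCASE family behind `not_DerivedPencilRolle` (`DPR.stub_stair`, `DPR.exists_symm_pencil_alternating`:
`L + 2` terms, size `4·(((2^L−1)(n+1)+1)·(2^L·n·2))^3 + 7 ≤ (256·2^(6L) + 7)·n^6`, `n^L − 1`
alternations) with `L = 7` levels beats any bound linear in the size: `stair_arith_exponent_one`.

* `not_derivedPencilRolleQuasi_exponent_one C` : the `A = 1` instance is false;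
* `step_exponent_one_of_exponent_zero` : the `A = 0` instance implies the `A = 1` instance (budget
  monotonicity, `2 ≤ (K+1)^K · 2^(log₂ m+2)`), so `A = 0` is false too (independently of ExponentFloor);
* `two_le_exponent_of_derivedPencilRolleQuasi_constants` : any `(C, A)` witnessing the crux have
  `2 ≤ A`;
* `not_derivedPencilRolleQuasi_with_exponent_le_one` : packaged — the crux with the extra constraint
  `A ≤ 1` is false.

What this does NOT touch: `A = 2, C = 0` is consistent with every family in the tree (staircase:
`log₂ Z₊ ≈ L log₂ n` against `(log₂ m)^2 ≥ (6L + 6 log₂ n)^2`; binarised Gajjar–Radhakrishnan bumps: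
`log Z = Θ(log² n)` against `(c log n)^2` with `c ≥ 8`); refuting the crux needs `2^((log m)^ω(1))`
positive roots from polynomial-size skew circuits over few monomials (a non-tropical alternation
mechanism), which is open.  [folklore] for the arithmetic; constructions are the tree's.
-/

-- `Summit.ValiantsHypothesis.ValiantsHypothesis.…` repeats a component by the D-0017 layout.
set_option linter.dupNamespace false

namespace Summit.ValiantsHypothesis.ValiantsHypothesis.Theorems.DerivedPencilRolleQuasi.Negative

open scoped BigOperators Matrix Polynomial
open Polynomial
open Summit.ValiantsHypothesis.ValiantsHypothesis.Theorems.SymmetroidDescartes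
  (posRoots_le_of_step alternations_le_of_step quasiBudget_mono)
open Summit.ValiantsHypothesis.ValiantsHypothesis.Theorems.SymmetroidDescartes.DPR
  (size_le stub_stair exists_symm_pencil_alternating)

/-! ## Arithmetic: seven staircase levels beat any size-linear bound -/

/-- The symmetrised staircase size with `L = 7` levels is at most `(256 · 2^42 + 7) · n^6`. [folklore] -/
theorem stairSize_seven_le (n : ℕ) (hn : 1 ≤ n) :
    4 * (((2 ^ 7 - 1) * (n + 1) + 1) * (2 ^ 7 * n * 2)) ^ 3 + 7 ≤ (256 * (2 ^ 7) ^ 6 + 7) * n ^ 6 := by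
  have h1 := size_le (2 ^ 7) n hn
  have h2 : (((2 ^ 7 - 1) * (n + 1) + 1) * (2 ^ 7 * n * 2)) ^ 3 ≤ (4 * (2 ^ 7) ^ 2 * n ^ 2) ^ 3 :=
    Nat.pow_le_pow_left h1 3
  have h3 : 1 ≤ n ^ 6 := Nat.one_le_pow _ _ hn
  calc 4 * (((2 ^ 7 - 1) * (n + 1) + 1) * (2 ^ 7 * n * 2)) ^ 3 + 7
      ≤ 4 * (4 * (2 ^ 7) ^ 2 * n ^ 2) ^ 3 + 7 * n ^ 6 := by nlinarith
    _ = (256 * (2 ^ 7) ^ 6 + 7) * n ^ 6 := by ring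

/-- With `L = 7` levels there is an even `n ≥ 2` such that `n^7 − 1` alternations beat the iterated
`A = 1` bound `9 · C^9 · (10^9 · 2^(log₂ m + 2))` at the symmetrised staircase size `m`. [folklore] -/
theorem stair_arith_exponent_one (C : ℕ) : ∃ n : ℕ, 2 ≤ n ∧ Even n ∧
    (7 + 1 + 1) * C ^ (7 + 1 + 1) * (((7 + 1 + 1) + 1) ^ (1 * (7 + 1 + 1)) *
      2 ^ (Nat.log 2 (4 * (((2 ^ 7 - 1) * (n + 1) + 1) * (2 ^ 7 * n * 2)) ^ 3 + 7) + 2) ^ 1)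
      < n ^ 7 - 1 := by
  set F : ℕ := 256 * (2 ^ 7) ^ 6 + 7 with hF
  set D : ℕ := 9 * C ^ 9 * (10 ^ 9 * 4) * F with hD
  refine ⟨2 * (D + 1), by omega, even_two_mul _, ?_⟩
  set n := 2 * (D + 1) with hn
  have hn1 : 1 ≤ n := by omega
  set M := 4 * (((2 ^ 7 - 1) * (n + 1) + 1) * (2 ^ 7 * n * 2)) ^ 3 + 7 with hM
  have hM0 : M ≠ 0 := by omega
  have hlog : 2 ^ (Nat.log 2 M + 2) ^ 1 ≤ 4 * M := by
    rw [pow_one, pow_add]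
    have := Nat.pow_log_le_self 2 hM0
    omega
  have hsize : M ≤ F * n ^ 6 := stairSize_seven_le n hn1
  have hbound : (7 + 1 + 1) * C ^ (7 + 1 + 1) * (((7 + 1 + 1) + 1) ^ (1 * (7 + 1 + 1)) *
      2 ^ (Nat.log 2 M + 2) ^ 1) ≤ D * n ^ 6 := by
    calc (7 + 1 + 1) * C ^ (7 + 1 + 1) * (((7 + 1 + 1) + 1) ^ (1 * (7 + 1 + 1)) * 2 ^ (Nat.log 2 M + 2) ^ 1)
        ≤ 9 * C ^ 9 * (10 ^ 9 * (4 * (F * n ^ 6))) := by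
          have : ((7 + 1 + 1) + 1) ^ (1 * (7 + 1 + 1)) = 10 ^ 9 := by norm_num
          rw [this]
          exact Nat.mul_le_mul_left _ (Nat.mul_le_mul_left _ (hlog.trans (Nat.mul_le_mul_left _ hsize)))
      _ = D * n ^ 6 := by rw [hD]; ring
  have hpow : 1 ≤ n ^ 6 := Nat.one_le_pow _ _ hn1
  have hmain : D * n ^ 6 + 2 ≤ n ^ 7 := by
    have h1 : n ^ 7 = n ^ 6 * n := by rw [pow_succ]
    have h2 : n ^ 6 * n = 2 * (D * n ^ 6) + 2 * n ^ 6 := by rw [hn]; ring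
    rw [h1, h2]
    omega
  omega

/-! ## The `A = 1` slice is false -/

/-- **The `A = 1` instance of `DerivedPencilRolleQuasi` is false for every multiplier `C`.**
Iterate (tree glue with the abstract budget `(K+1)^(1·K)·2^((log₂ m+2)^1)`), perturb to arbitrary
symmetric pencils and alternations, and confront with the staircase family at `L = 7`. [folklore] -/
theorem not_derivedPencilRolleQuasi_exponent_one (C : ℕ) :
    ¬ ∀ (m K : ℕ) (S : Fin (K + 1) → Matrix (Fin m) (Fin m) ℝ) (d : Fin (K + 1) → ℕ),
      (∀ l, (S l).IsSymm) → (∀ l, (S l).det ≠ 0) → StrictMono d →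
        ((∑ l, (Polynomial.X : Polynomial ℝ) ^ d l • (S l).map Polynomial.C).det.roots.toFinset.filter
            (fun t => 0 < t)).card ≤
          C * ((∑ l : Fin K, (Polynomial.X : Polynomial ℝ) ^ (d l.succ - d 0 - 1) •
            (((d l.succ - d 0 : ℕ) : ℝ) • S l.succ).map Polynomial.C).det.roots.toFinset.filter
              (fun t => 0 < t)).card + (K + 1) ^ (1 * K) * 2 ^ (Nat.log 2 m + 2) ^ 1 := by
  intro h
  -- iterate the step with the abstract budget `B m K = (K+1)^(1·K) · 2^((log₂ m+2)^1)`
  have hiter := posRoots_le_of_step C (fun m K => (K + 1) ^ (1 * K) * 2 ^ (Nat.log 2 m + 2) ^ 1)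
    (fun m K K' hKK' => quasiBudget_mono 1 m K K' hKK') h
  -- merge/perturb: alternations of ARBITRARY symmetric pencils are bounded
  have hbound := alternations_le_of_step (max C 1) (le_max_right _ _)
    (fun m K => (K + 1) ^ (1 * K) * 2 ^ (Nat.log 2 m + 2) ^ 1)
    (fun m K K' hKK' => quasiBudget_mono 1 m K K' hKK') hiter
  -- the staircase with `L = 7` levels
  obtain ⟨n, hn, he, harith⟩ := stair_arith_exponent_one (max C 1)
  have hnL : 1 ≤ n ^ 7 := Nat.one_le_pow _ _ (by omega)
  obtain ⟨g, d, v₀, lam, wstar, c, hlen, hlam, hc, hgap, hsign⟩ :=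
    stub_stair n 7 (n ^ 7 - 1) hn he (by norm_num) (Nat.sub_add_cancel hnL)
  obtain ⟨S, e, hS, τ, hτ, hpos, halt⟩ :=
    exists_symm_pencil_alternating d g v₀ lam wstar c hlam hc hgap hsign
  have hN := hbound (7 + 1 + 1) _ S e hS (n ^ 7 - 1) τ hτ hpos halt
  rw [hlen, Fintype.card_prod, Fintype.card_fin, Fintype.card_bool] at hN
  exact absurd harith (not_lt.2 hN)

/-- The `A = 0` instance implies the `A = 1` instance (the budget only grows:
`(K+1)^0 · 2^1 = 2 ≤ (K+1)^K · 2^(log₂ m + 2)`). [folklore] -/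
theorem step_exponent_one_of_exponent_zero (C : ℕ)
    (h : ∀ (m K : ℕ) (S : Fin (K + 1) → Matrix (Fin m) (Fin m) ℝ) (d : Fin (K + 1) → ℕ),
      (∀ l, (S l).IsSymm) → (∀ l, (S l).det ≠ 0) → StrictMono d →
        ((∑ l, (Polynomial.X : Polynomial ℝ) ^ d l • (S l).map Polynomial.C).det.roots.toFinset.filter
            (fun t => 0 < t)).card ≤
          C * ((∑ l : Fin K, (Polynomial.X : Polynomial ℝ) ^ (d l.succ - d 0 - 1) •
            (((d l.succ - d 0 : ℕ) : ℝ) • S l.succ).map Polynomial.C).det.roots.toFinset.filter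
              (fun t => 0 < t)).card + (K + 1) ^ (0 * K) * 2 ^ (Nat.log 2 m + 2) ^ 0) :
    ∀ (m K : ℕ) (S : Fin (K + 1) → Matrix (Fin m) (Fin m) ℝ) (d : Fin (K + 1) → ℕ),
      (∀ l, (S l).IsSymm) → (∀ l, (S l).det ≠ 0) → StrictMono d →
        ((∑ l, (Polynomial.X : Polynomial ℝ) ^ d l • (S l).map Polynomial.C).det.roots.toFinset.filter
            (fun t => 0 < t)).card ≤
          C * ((∑ l : Fin K, (Polynomial.X : Polynomial ℝ) ^ (d l.succ - d 0 - 1) •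
            (((d l.succ - d 0 : ℕ) : ℝ) • S l.succ).map Polynomial.C).det.roots.toFinset.filter
              (fun t => 0 < t)).card + (K + 1) ^ (1 * K) * 2 ^ (Nat.log 2 m + 2) ^ 1 := by
  intro m K S d hS hdet hd
  refine (h m K S d hS hdet hd).trans (Nat.add_le_add_left ?_ _)
  have h1 : 1 ≤ (K + 1) ^ (1 * K) := Nat.one_le_pow _ _ (Nat.succ_pos K)
  have h2 : 2 ≤ 2 ^ (Nat.log 2 m + 2) ^ 1 := by
    rw [pow_one, pow_add]
    have : 1 ≤ 2 ^ Nat.log 2 m := Nat.one_le_two_pow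
    omega
  calc (K + 1) ^ (0 * K) * 2 ^ (Nat.log 2 m + 2) ^ 0 = 1 * 2 := by simp
    _ ≤ (K + 1) ^ (1 * K) * 2 ^ (Nat.log 2 m + 2) ^ 1 := Nat.mul_le_mul h1 h2

/-- **Any constants `(C, A)` witnessing `DerivedPencilRolleQuasi` have `A ≥ 2`.** [folklore] -/
theorem two_le_exponent_of_derivedPencilRolleQuasi_constants (C A : ℕ)
    (h : ∀ (m K : ℕ) (S : Fin (K + 1) → Matrix (Fin m) (Fin m) ℝ) (d : Fin (K + 1) → ℕ),
      (∀ l, (S l).IsSymm) → (∀ l, (S l).det ≠ 0) → StrictMono d →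
        ((∑ l, (Polynomial.X : Polynomial ℝ) ^ d l • (S l).map Polynomial.C).det.roots.toFinset.filter
            (fun t => 0 < t)).card ≤
          C * ((∑ l : Fin K, (Polynomial.X : Polynomial ℝ) ^ (d l.succ - d 0 - 1) •
            (((d l.succ - d 0 : ℕ) : ℝ) • S l.succ).map Polynomial.C).det.roots.toFinset.filter
              (fun t => 0 < t)).card + (K + 1) ^ (A * K) * 2 ^ (Nat.log 2 m + 2) ^ A) :
    2 ≤ A := by
  rcases A with _ | _ | A
  · exact absurd (step_exponent_one_of_exponent_zero C h) (not_derivedPencilRolleQuasi_exponent_one C)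
  · exact absurd h (not_derivedPencilRolleQuasi_exponent_one C)
  · omega

/-- Packaged against the route decl: `DerivedPencilRolleQuasi` with the extra constraint `A ≤ 1` is
false (the crux can only hold with a genuinely quasi-polynomial-in-size slack, `A ≥ 2`). [folklore] -/
theorem not_derivedPencilRolleQuasi_with_exponent_le_one :
    ¬ ∃ C A : ℕ, A ≤ 1 ∧ ∀ (m K : ℕ) (S : Fin (K + 1) → Matrix (Fin m) (Fin m) ℝ) (d : Fin (K + 1) → ℕ),
      (∀ l, (S l).IsSymm) → (∀ l, (S l).det ≠ 0) → StrictMono d →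
        ((∑ l, (Polynomial.X : Polynomial ℝ) ^ d l • (S l).map Polynomial.C).det.roots.toFinset.filter
            (fun t => 0 < t)).card ≤
          C * ((∑ l : Fin K, (Polynomial.X : Polynomial ℝ) ^ (d l.succ - d 0 - 1) •
            (((d l.succ - d 0 : ℕ) : ℝ) • S l.succ).map Polynomial.C).det.roots.toFinset.filter
              (fun t => 0 < t)).card + (K + 1) ^ (A * K) * 2 ^ (Nat.log 2 m + 2) ^ A :=
  fun ⟨C, A, hA, h⟩ => absurd (two_le_exponent_of_derivedPencilRolleQuasi_constants C A h) (by omega)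

end Summit.ValiantsHypothesis.ValiantsHypothesis.Theorems.DerivedPencilRolleQuasi.Negative
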